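import Mathlib
import Literature.MathematicalPhysics.QuantumLattice.InfVolFermionState
import HarnessLib

/-!
# Weak-⋆ compactness of translation-averaged torus states: thermodynamic-limit states exist

Topic `Literature/MathematicalPhysics/QuantumLattice`; namespace
`Literature.MathematicalPhysics.QuantumLattice` (the file path). Companion of
`InfVolFermionState.lean` (definition request `defn-InfVolFermionState` of route
`HubbardSuperconductivity/InfiniteVolumeFirst`, crux `NoNormalLimitState`; first lemma
`TorusLimitExists` of the idea card `bkr-minimiser-exclusion`). Everything below is PROVED; the
file introduces no definition and no named fact.

## Main result

`InfVolFermionState.exists_isTorusLimitOf_subseq`: for every family `ψ L` of Fock vectors of the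
fermionic tori `(ℤ/Lℤ)^d × {↑,↓}`, every side sequence `Ls → ∞` along which the `ψ (Ls j)` are unit
vectors has a subsequence `Ls ∘ φ` and an infinite-volume state `ω : InfVolFermionState d` (a state
of the CAR algebra over `ℤ^d × {↑,↓}`) with `ω.IsTorusLimitOf ψ (Ls ∘ φ)`: the translation-averaged
expectations of EVERY local observable converge along the subsequence to its `ω`-expectation.
Corollary `exists_isTorusLimitOf_subseq_of_isNParticle`: for fixed-particle-number families the
limit state is translation invariant and even (by the structural theorems of
`InfVolFermionState.lean`).

This is the Banach–Alaoglu / weak-⋆ compactness of the state space of the quasi-local algebra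
(Bratteli–Robinson I, Thm. 2.3.15: the state space of a unital C⋆-algebra is weak-⋆ compact;
Prop. 2.6.13–2.6.15 ff. and §4.3.1 for thermodynamic limits of finite-volume states), carried out
by hand for this separable situation: the local algebras `𝔄_Λ` are matrix algebras with the
countably many matrix units `|s⟩⟨t|` (`Matrix.single s t 1`), `Λ ⊆ ℤ^d` finite, as coordinates.

## Proof

* `torusAvgExpect_sum_smul`, `torusAvgExpect_eq_sum_single`: the averaged torus expectation is
  linear in the observable, hence determined by its values on matrix units.
* `norm_torusAvgExpect_single_le`: on a matrix unit it has modulus `≤ 1` for unit vectors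
  (`Γ(|s⟩⟨t|)⋆ Γ(|s⟩⟨t|) = Γ(|t⟩⟨t|)` is an orthogonal projection, `re_star_dotProduct_proj_mulVec_le`; Cauchy–Schwarz).
* Tychonoff (`isCompact_univ_pi`) on the countable product of closed unit discs and first
  countability give a subsequence along which ALL coordinates converge
  (`IsCompact.tendsto_subseq`); the limit functional `A ↦ Σ_{s,t} A_{st} g(Λ,s,t)` is linear, and
  normalisation (`torusAvgExpect_one`), positivity (`torusAvgExpect_conjTranspose_mul_self_nonneg`)
  and compatibility along the isotony maps (`torusAvgExpect_fermionEmbed_incl`) pass to the limit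
  because they hold at every finite side as soon as the region fits into the torus
  (`eventually_injOn_proj_of_tendsto`).

## Sources

* O. Bratteli, D. W. Robinson, *Operator Algebras and Quantum Statistical Mechanics 1*, 2nd ed.
  [BratteliRobinsonI1987]: Thm. 2.3.15 (weak-⋆ compactness of the state space), §4.3.1
  (invariant states as limits of averages).
* O. Bratteli, D. W. Robinson, *OAQSM 2* [BratteliRobinsonII1997] §6.2.2 (thermodynamic limit of
  finite-volume states with periodic boundary conditions).

## What is NOT here

No uniqueness of the limit (there is none in general), no identification of the limit as a ground
state / energy minimiser (the idea card's second stub `TorusLimitMinimises`), nothing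
model-specific.
-/

noncomputable section

namespace Literature.MathematicalPhysics.QuantumLattice

open Matrix Finset HubbardWave0 _root_.Filter Literature.Probability.LatticeModels
open scoped _root_.Topology ComplexOrder

/-! ### An elementary Hilbert-space inequality -/

section Elementary

variable {n : Type*} [Fintype n]

/-- For an orthogonal projection `P` (`Pᴴ = P`, `P² = P`) and any vector `φ`:
`‖P φ‖² ≤ ‖φ‖²`, i.e. `Re((Pφ)⋆ · Pφ) ≤ Re(φ⋆ · φ)` (Pythagoras with `(1 - P)φ`). [folklore] -/
theorem re_star_dotProduct_proj_mulVec_le {P : Matrix n n ℂ} (hP : Pᴴ = P) (hP2 : P * P = P)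
    (φ : n → ℂ) : (star (P *ᵥ φ) ⬝ᵥ (P *ᵥ φ)).re ≤ (star φ ⬝ᵥ φ).re := by
  classical
  have h1 : star (P *ᵥ φ) ⬝ᵥ (P *ᵥ φ) = star φ ⬝ᵥ (P *ᵥ φ) := by
    rw [star_mulVec, ← dotProduct_mulVec, mulVec_mulVec, hP, hP2]
  have hQ : (1 - P)ᴴ = 1 - P := by rw [conjTranspose_sub, conjTranspose_one, hP]
  have hQ2 : (1 - P) * (1 - P) = 1 - P := by
    rw [Matrix.sub_mul, Matrix.mul_sub, Matrix.mul_sub, Matrix.one_mul, Matrix.one_mul,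
      Matrix.mul_one, hP2, sub_self, sub_zero]
  have h2 : star ((1 - P) *ᵥ φ) ⬝ᵥ ((1 - P) *ᵥ φ) = star φ ⬝ᵥ ((1 - P) *ᵥ φ) := by
    rw [star_mulVec, ← dotProduct_mulVec, mulVec_mulVec, hQ, hQ2]
  have hsplit : star φ ⬝ᵥ φ = star (P *ᵥ φ) ⬝ᵥ (P *ᵥ φ) + star ((1 - P) *ᵥ φ) ⬝ᵥ ((1 - P) *ᵥ φ) := by
    rw [h1, h2, ← dotProduct_add, ← Matrix.add_mulVec, add_sub_cancel, Matrix.one_mulVec]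
  have h0 : (0 : ℂ).re ≤ (star ((1 - P) *ᵥ φ) ⬝ᵥ ((1 - P) *ᵥ φ)).re :=
    (Complex.le_def.1 (dotProduct_star_self_nonneg _)).1
  rw [hsplit, Complex.add_re]
  rw [Complex.zero_re] at h0
  linarith

end Elementary

/-! ### Matrix units under a second quantisation `Γ(f)` -/

section MatrixUnits

variable {Λ₀ Λ₀' : Type*} [LinearOrder Λ₀] [Fintype Λ₀] [LinearOrder Λ₀'] [Fintype Λ₀']

/-- **`|⟨φ, Γ(|s⟩⟨t|) φ⟩| ≤ ⟨φ, φ⟩`** for the second quantisation `Γ(f)` of an injection of sites and a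
matrix unit `|s⟩⟨t|` of the smaller Fock space: `Γ(|s⟩⟨t|)⋆Γ(|s⟩⟨t|) = Γ(|t⟩⟨t|)` is an orthogonal
projection, so `‖Γ(|s⟩⟨t|)φ‖ ≤ ‖φ‖`, and Cauchy–Schwarz. [folklore] -/
theorem norm_expect_fermionEmbed_single_le [DecidableEq (Finset (Orb Λ₀))] (f : Λ₀ ↪ Λ₀')
    (s t : Finset (Orb Λ₀)) (φ : Fock (Orb Λ₀')) :
    ‖expect (fermionEmbed f (Matrix.single s t (1 : ℂ))) φ‖ ≤ (star φ ⬝ᵥ φ).re := by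
  set E := fermionEmbed f (Matrix.single s t (1 : ℂ)) with hE
  set P := fermionEmbed f (Matrix.single t t (1 : ℂ)) with hP
  have hEE : Eᴴ * E = P := by
    rw [hE, ← fermionEmbed_conjTranspose, ← fermionEmbed_mul, conjTranspose_single, star_one,
      single_mul_single_same, mul_one]
  have hPh : Pᴴ = P := by
    rw [hP, ← fermionEmbed_conjTranspose, conjTranspose_single, star_one]
  have hP2 : P * P = P := by
    rw [hP, ← fermionEmbed_mul, single_mul_single_same, mul_one]
  have hnormE : (star (E *ᵥ φ) ⬝ᵥ (E *ᵥ φ)).re ≤ (star φ ⬝ᵥ φ).re := by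
    have h1 : star (E *ᵥ φ) ⬝ᵥ (E *ᵥ φ) = star (P *ᵥ φ) ⬝ᵥ (P *ᵥ φ) := by
      rw [star_mulVec, ← dotProduct_mulVec, mulVec_mulVec, hEE, star_mulVec, ← dotProduct_mulVec,
        mulVec_mulVec, hPh, hP2]
    rw [h1]
    exact re_star_dotProduct_proj_mulVec_le hPh hP2 φ
  have h0 : 0 ≤ (star φ ⬝ᵥ φ).re := by
    have := (Complex.le_def.1 (dotProduct_star_self_nonneg φ)).1
    rwa [Complex.zero_re] at this
  -- `Re (v⋆ · v) = Σ_i |v_i|²` and Cauchy–Schwarz for the complex dot product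
  have hre : ∀ v : Finset (Orb Λ₀') → ℂ, (star v ⬝ᵥ v).re = ∑ i, ‖v i‖ ^ 2 := fun v => by
    rw [dotProduct, Complex.re_sum]
    refine Finset.sum_congr rfl fun i _ => ?_
    rw [Pi.star_apply, Complex.star_def, Complex.conj_mul', ← Complex.ofReal_pow, Complex.ofReal_re]
  have hCS : ∀ u w : Finset (Orb Λ₀') → ℂ,
      ‖star u ⬝ᵥ w‖ ≤ Real.sqrt ((star u ⬝ᵥ u).re) * Real.sqrt ((star w ⬝ᵥ w).re) := fun u w => by
    rw [hre, hre]
    calc ‖star u ⬝ᵥ w‖ ≤ ∑ i, ‖star (u i) * w i‖ := norm_sum_le _ _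
      _ = ∑ i, ‖u i‖ * ‖w i‖ := Finset.sum_congr rfl fun i _ => by rw [norm_mul, norm_star]
      _ ≤ _ := Real.sum_mul_le_sqrt_mul_sqrt _ _ _
  calc ‖expect E φ‖ = ‖star φ ⬝ᵥ (E *ᵥ φ)‖ := rfl
    _ ≤ Real.sqrt ((star φ ⬝ᵥ φ).re) * Real.sqrt ((star (E *ᵥ φ) ⬝ᵥ (E *ᵥ φ)).re) := hCS _ _
    _ ≤ Real.sqrt ((star φ ⬝ᵥ φ).re) * Real.sqrt ((star φ ⬝ᵥ φ).re) :=
        mul_le_mul_of_nonneg_left (Real.sqrt_le_sqrt hnormE) (Real.sqrt_nonneg _)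
    _ = (star φ ⬝ᵥ φ).re := Real.mul_self_sqrt h0

/-- The expectation of `Γ(f)(Aᴴ A)` in any vector is nonnegative (`= ‖Γ(f)(A) φ‖²`). [folklore] -/
theorem expect_fermionEmbed_conjTranspose_mul_self_nonneg (f : Λ₀ ↪ Λ₀')
    (A : Matrix (Finset (Orb Λ₀)) (Finset (Orb Λ₀)) ℂ) (φ : Fock (Orb Λ₀')) :
    0 ≤ expect (fermionEmbed f (Aᴴ * A)) φ := by
  rw [fermionEmbed_conjTranspose_mul_self, expect, ← mulVec_mulVec, dotProduct_mulVec,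
    ← star_mulVec]
  exact dotProduct_star_self_nonneg _

end MatrixUnits

/-! ### The averaged torus expectation: linearity, bounds, positivity, compatibility -/

section TorusAverages

variable {d : ℕ}

/-- The averaged torus expectation is linear in the observable (finite linear combinations).
[folklore] -/
theorem torusAvgExpectAt_sum_smul (L : ℕ) [NeZero L] (Λ : Finset (Site d)) {κ : Type*}
    (S : Finset κ) (c : κ → ℂ) (A : κ → FermionOp Λ) (ψ : Fock (Orb (FermionTorus d L))) :
    torusAvgExpectAt L Λ (∑ k ∈ S, c k • A k) ψ = ∑ k ∈ S, c k * torusAvgExpectAt L Λ (A k) ψ := by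
  by_cases h : Set.InjOn (Torus.proj (d := d) L) ↑Λ
  · simp_rw [torusAvgExpectAt_of_injOn L h]
    rw [fermionEmbed_sum]
    simp_rw [fermionEmbed_smul]
    have hexp : ∀ φ : Fock (Orb (FermionTorus d L)),
        expect (∑ k ∈ S, c k • fermionEmbed (PolySite.toTorusEmb L h) (A k)) φ =
          ∑ k ∈ S, c k * expect (fermionEmbed (PolySite.toTorusEmb L h) (A k)) φ := by
      intro φ
      rw [expect, Matrix.sum_mulVec, dotProduct_sum]
      refine Finset.sum_congr rfl fun k _ => ?_
      rw [Matrix.smul_mulVec, dotProduct_smul, smul_eq_mul, expect]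
    simp_rw [hexp]
    rw [Finset.sum_comm, Finset.mul_sum]
    refine Finset.sum_congr rfl fun k _ => ?_
    rw [← Finset.mul_sum]
    ring
  · simp_rw [torusAvgExpectAt_of_not_injOn L h]
    simp

/-- `torusAvgExpectAt_sum_smul` for an arbitrary side `L : ℕ`. [folklore] -/
theorem torusAvgExpect_sum_smul (L : ℕ) (Λ : Finset (Site d)) {κ : Type*}
    (S : Finset κ) (c : κ → ℂ) (A : κ → FermionOp Λ) (ψ : Fock (Orb (FermionTorus d L))) :
    torusAvgExpect L Λ (∑ k ∈ S, c k • A k) ψ = ∑ k ∈ S, c k * torusAvgExpect L Λ (A k) ψ := by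
  rcases Nat.eq_zero_or_pos L with rfl | hL
  · simp
  · haveI : NeZero L := NeZero.of_pos hL
    simp_rw [torusAvgExpect_eq]
    exact torusAvgExpectAt_sum_smul L Λ S c A ψ

/-- **Expansion in matrix units**: the averaged torus expectation of `A ∈ 𝔄_Λ` is
`Σ_{s,t} A_{st} ·` (averaged torus expectation of the matrix unit `|s⟩⟨t|`). [folklore] -/
theorem torusAvgExpect_eq_sum_single (L : ℕ) (Λ : Finset (Site d)) (A : FermionOp Λ)
    (ψ : Fock (Orb (FermionTorus d L))) :
    torusAvgExpect L Λ A ψ =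
      ∑ s, ∑ t, A s t * torusAvgExpect L Λ (Matrix.single s t (1 : ℂ)) ψ := by
  have hA : A = ∑ p : Finset (Orb (PolySite Λ)) × Finset (Orb (PolySite Λ)),
      A p.1 p.2 • Matrix.single p.1 p.2 (1 : ℂ) := by
    conv_lhs => rw [matrix_eq_sum_single A, ← Fintype.sum_prod_type']
    refine Finset.sum_congr rfl fun p _ => ?_
    rw [smul_single, smul_eq_mul, mul_one]
  conv_lhs => rw [hA]
  rw [torusAvgExpect_sum_smul, ← Fintype.sum_prod_type']

/-- **Uniform bound on matrix units**: for a unit vector `ψ`, the averaged torus expectation of a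
matrix unit `|s⟩⟨t|` has modulus `≤ 1` (every translate `U_v ψ` is a unit vector and
`|⟨φ, Γ(|s⟩⟨t|) φ⟩| ≤ ‖φ‖²`; the junk branches give `0`). [folklore] -/
theorem norm_torusAvgExpect_single_le (L : ℕ) (Λ : Finset (Site d))
    (s t : Finset (Orb (PolySite Λ))) {ψ : Fock (Orb (FermionTorus d L))} (hψ : star ψ ⬝ᵥ ψ = 1) :
    ‖torusAvgExpect L Λ (Matrix.single s t (1 : ℂ)) ψ‖ ≤ 1 := by
  rcases Nat.eq_zero_or_pos L with rfl | hL
  · rw [torusAvgExpect_zero, norm_zero]; exact zero_le_one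
  haveI : NeZero L := NeZero.of_pos hL
  rw [torusAvgExpect_eq]
  by_cases h : Set.InjOn (Torus.proj (d := d) L) ↑Λ
  · rw [torusAvgExpectAt_of_injOn L h, norm_mul, norm_inv, Complex.norm_natCast]
    have hcard : (0 : ℝ) < Fintype.card (TorusSite d L) := Nat.cast_pos.2 Fintype.card_pos
    calc (Fintype.card (TorusSite d L) : ℝ)⁻¹ *
          ‖∑ v : TorusSite d L, expect (fermionEmbed (PolySite.toTorusEmb L h)
              (Matrix.single s t (1 : ℂ))) ((fockTranslate v).val *ᵥ ψ)‖
        ≤ (Fintype.card (TorusSite d L) : ℝ)⁻¹ * ∑ _v : TorusSite d L, (1 : ℝ) := by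
          refine mul_le_mul_of_nonneg_left ((norm_sum_le _ _).trans
            (Finset.sum_le_sum fun v _ => ?_)) (inv_nonneg.2 hcard.le)
          have h1 := norm_expect_fermionEmbed_single_le (PolySite.toTorusEmb L h) s t
            ((fockTranslate v).val *ᵥ ψ)
          rwa [star_fockRelabel_mulVec_dotProduct, hψ, Complex.one_re] at h1
      _ = 1 := by
          rw [sum_const, card_univ, nsmul_eq_mul, mul_one, inv_mul_cancel₀ hcard.ne']
  · rw [torusAvgExpectAt_of_not_injOn L h, norm_zero]; exact zero_le_one

/-- **Positivity**: the averaged torus expectation of `Aᴴ A` is nonnegative (each term is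
`‖Γ(A) U_v ψ‖² ≥ 0`; the junk branches give `0`). [folklore] -/
theorem torusAvgExpect_conjTranspose_mul_self_nonneg (L : ℕ) (Λ : Finset (Site d)) (A : FermionOp Λ)
    (ψ : Fock (Orb (FermionTorus d L))) : 0 ≤ torusAvgExpect L Λ (Aᴴ * A) ψ := by
  rcases Nat.eq_zero_or_pos L with rfl | hL
  · rw [torusAvgExpect_zero]
  haveI : NeZero L := NeZero.of_pos hL
  rw [torusAvgExpect_eq]
  by_cases h : Set.InjOn (Torus.proj (d := d) L) ↑Λ
  · rw [torusAvgExpectAt_of_injOn L h]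
    refine mul_nonneg ?_ (Finset.sum_nonneg fun v _ =>
      expect_fermionEmbed_conjTranspose_mul_self_nonneg _ A _)
    have hc : ((Fintype.card (TorusSite d L) : ℂ))⁻¹ =
        (((Fintype.card (TorusSite d L) : ℝ)⁻¹ : ℝ) : ℂ) := by
      push_cast; rfl
    rw [hc]
    exact Complex.zero_le_real.2 (inv_nonneg.2 (Nat.cast_nonneg _))
  · rw [torusAvgExpectAt_of_not_injOn L h]

/-- **Normalisation**: once `Λ` fits into the torus, the averaged torus expectation of `𝟙 ∈ 𝔄_Λ` in
a unit vector is `1` (`Γ(𝟙) = 𝟙`, the translates are unit vectors). [folklore] -/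
theorem torusAvgExpect_one (L : ℕ) [NeZero L] {Λ : Finset (Site d)}
    (h : Set.InjOn (Torus.proj (d := d) L) ↑Λ) {ψ : Fock (Orb (FermionTorus d L))}
    (hψ : star ψ ⬝ᵥ ψ = 1) : torusAvgExpect L Λ 1 ψ = 1 := by
  rw [torusAvgExpect_eq, torusAvgExpectAt_of_injOn L h, fermionEmbed_one]
  have hcard : (Fintype.card (TorusSite d L) : ℂ) ≠ 0 := Nat.cast_ne_zero.2 Fintype.card_ne_zero
  simp only [expect, Matrix.one_mulVec, star_fockRelabel_mulVec_dotProduct, hψ, sum_const, card_univ,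
    nsmul_eq_mul, mul_one]
  exact inv_mul_cancel₀ hcard

/-- **Compatibility with isotony at finite side**: for `Λ ⊆ Λ'` fitting into the torus, the averaged
torus expectation of `Γ_{Λ ⊆ Λ'}(A) ∈ 𝔄_{Λ'}` equals that of `A ∈ 𝔄_Λ` (functoriality
`Γ(ι_{Λ',L}) ∘ Γ(Λ ⊆ Λ') = Γ(ι_{Λ,L})`). [folklore] -/
theorem torusAvgExpectAt_fermionEmbed_incl (L : ℕ) [NeZero L] {Λ Λ' : Finset (Site d)} (hΛ : Λ ⊆ Λ')
    (h' : Set.InjOn (Torus.proj (d := d) L) ↑Λ') (A : FermionOp Λ) (ψ : Fock (Orb (FermionTorus d L))) :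
    torusAvgExpectAt L Λ' (fermionEmbed (PolySite.incl hΛ) A) ψ = torusAvgExpectAt L Λ A ψ := by
  have h : Set.InjOn (Torus.proj (d := d) L) ↑Λ := Set.InjOn.mono (Finset.coe_subset.2 hΛ) h'
  rw [torusAvgExpectAt_of_injOn L h', torusAvgExpectAt_of_injOn L h, fermionEmbed_fermionEmbed]
  have key : (PolySite.incl hΛ).trans (PolySite.toTorusEmb L h') = PolySite.toTorusEmb L h :=
    DFunLike.ext _ _ fun _ => rfl
  rw [key]

/-- `torusAvgExpectAt_fermionEmbed_incl` for an arbitrary side `L : ℕ`. [folklore] -/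
theorem torusAvgExpect_fermionEmbed_incl (L : ℕ) {Λ Λ' : Finset (Site d)} (hΛ : Λ ⊆ Λ')
    (h' : Set.InjOn (Torus.proj (d := d) L) ↑Λ') (A : FermionOp Λ) (ψ : Fock (Orb (FermionTorus d L))) :
    torusAvgExpect L Λ' (fermionEmbed (PolySite.incl hΛ) A) ψ = torusAvgExpect L Λ A ψ := by
  rcases Nat.eq_zero_or_pos L with rfl | hL
  · rw [torusAvgExpect_zero, torusAvgExpect_zero]
  · haveI : NeZero L := NeZero.of_pos hL
    rw [torusAvgExpect_eq, torusAvgExpect_eq, torusAvgExpectAt_fermionEmbed_incl L hΛ h']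

end TorusAverages

/-! ### The compactness theorem -/

section Compactness

variable {d : ℕ}

/-- **Thermodynamic-limit states exist (weak-⋆ compactness).** For every family `ψ L` of Fock
vectors of the fermionic tori of sides `L`, and every side sequence `Ls → ∞` along which the `ψ`
are unit vectors, there are a subsequence `Ls ∘ φ` (`φ` strictly increasing) and an infinite-volume
state `ω` of the lattice fermion system on `ℤ^d` such that `ω` is the torus limit of `ψ` along
`Ls ∘ φ`: for every finite region `Λ` and every local observable `A ∈ 𝔄_Λ`, the
translation-averaged expectation of `A` in `ψ (Ls (φ j))` converges to `ω_Λ(A)`.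
(Banach–Alaoglu for the separable quasi-local algebra, by the Cantor–Tychonoff diagonal argument on
the countably many matrix-unit coordinates, each bounded by `1`; linearity, normalisation,
positivity and compatibility of the limit are closed conditions.)
[cite: BratteliRobinsonI1987, Thm. 2.3.15 (weak-⋆ compactness of the state space) and §4.3.1] -/
theorem InfVolFermionState.exists_isTorusLimitOf_subseq (ψ : ∀ L, Fock (Orb (FermionTorus d L)))
    {Ls : ℕ → ℕ} (hLs : Tendsto Ls atTop atTop) (hψ : ∀ j, star (ψ (Ls j)) ⬝ᵥ ψ (Ls j) = 1) :
    ∃ φ : ℕ → ℕ, StrictMono φ ∧ ∃ ω : InfVolFermionState d, ω.IsTorusLimitOf ψ (Ls ∘ φ) := by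
  -- coordinates: the values on the matrix units `|s⟩⟨t|` of all local algebras
  let c : ℕ → (Σ Λ : Finset (Site d), Finset (Orb (PolySite Λ)) × Finset (Orb (PolySite Λ))) → ℂ :=
    fun j i => torusAvgExpect (Ls j) i.1 (Matrix.single i.2.1 i.2.2 (1 : ℂ)) (ψ (Ls j))
  have hK : IsCompact (Set.pi Set.univ fun _ :
      (Σ Λ : Finset (Site d), Finset (Orb (PolySite Λ)) × Finset (Orb (PolySite Λ))) =>
        Metric.closedBall (0 : ℂ) 1) :=
    isCompact_univ_pi fun _ => isCompact_closedBall (0 : ℂ) 1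
  have hc : ∀ j, c j ∈ Set.pi Set.univ fun _ :
      (Σ Λ : Finset (Site d), Finset (Orb (PolySite Λ)) × Finset (Orb (PolySite Λ))) =>
        Metric.closedBall (0 : ℂ) 1 := fun j i _ => by
    rw [Metric.mem_closedBall, dist_zero_right]
    exact norm_torusAvgExpect_single_le _ _ _ _ (hψ j)
  obtain ⟨g, -, φ, hφ, hg⟩ := hK.tendsto_subseq hc
  have hcoord : ∀ i : (Σ Λ : Finset (Site d), Finset (Orb (PolySite Λ)) × Finset (Orb (PolySite Λ))),
      Tendsto (fun j => c (φ j) i) atTop (𝓝 (g i)) := fun i => tendsto_pi_nhds.1 hg i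
  -- the limit functional and the convergence of all averaged expectations along the subsequence
  let lim : ∀ Λ : Finset (Site d), FermionOp Λ → ℂ := fun Λ A => ∑ s, ∑ t, A s t * g ⟨Λ, (s, t)⟩
  have hlim : ∀ (Λ : Finset (Site d)) (A : FermionOp Λ),
      Tendsto (fun j => torusAvgExpect (Ls (φ j)) Λ A (ψ (Ls (φ j)))) atTop (𝓝 (lim Λ A)) := by
    intro Λ A
    simp_rw [torusAvgExpect_eq_sum_single _ Λ A]
    refine tendsto_finsetSum _ fun s _ => tendsto_finsetSum _ fun t _ => ?_
    exact (hcoord ⟨Λ, (s, t)⟩).const_mul _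
  have hLφ : Tendsto (Ls ∘ φ) atTop atTop := hLs.comp hφ.tendsto_atTop
  -- the limit functional is linear
  let E : ∀ Λ : Finset (Site d), FermionOp Λ →ₗ[ℂ] ℂ := fun Λ =>
    { toFun := lim Λ
      map_add' := fun A B => by
        simp only [lim, Matrix.add_apply, add_mul, Finset.sum_add_distrib]
      map_smul' := fun a A => by
        simp only [lim, Matrix.smul_apply, smul_eq_mul, mul_assoc, Finset.mul_sum, RingHom.id_apply] }
  -- normalisation
  have h_one : ∀ Λ : Finset (Site d), E Λ 1 = 1 := by
    intro Λ
    refine tendsto_nhds_unique (hlim Λ 1) ?_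
    refine (tendsto_const_nhds (x := (1 : ℂ))).congr' ?_
    filter_upwards [eventually_injOn_proj_of_tendsto Λ hLφ, hLφ.eventually_ge_atTop 1] with j hj hj1
    haveI : NeZero (Ls (φ j)) := ⟨Nat.one_le_iff_ne_zero.1 hj1⟩
    exact (torusAvgExpect_one (Ls (φ j)) hj (hψ (φ j))).symm
  -- positivity
  have h_nonneg : ∀ (Λ : Finset (Site d)) (A : FermionOp Λ), 0 ≤ E Λ (Aᴴ * A) := fun Λ A =>
    ge_of_tendsto' (hlim Λ (Aᴴ * A)) fun j => torusAvgExpect_conjTranspose_mul_self_nonneg _ _ _ _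
  -- compatibility
  have h_comp : ∀ ⦃Λ Λ' : Finset (Site d)⦄ (h : Λ ⊆ Λ') (A : FermionOp Λ),
      E Λ' (fermionEmbed (PolySite.incl h) A) = E Λ A := by
    intro Λ Λ' h A
    refine tendsto_nhds_unique (hlim Λ' (fermionEmbed (PolySite.incl h) A)) ?_
    refine (hlim Λ A).congr' ?_
    filter_upwards [eventually_injOn_proj_of_tendsto Λ' hLφ] with j hj
    exact (torusAvgExpect_fermionEmbed_incl _ h hj A _).symm
  exact ⟨φ, hφ, ⟨E, h_one, h_nonneg, h_comp⟩, fun Λ A => hlim Λ A⟩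

/-- **Thermodynamic-limit states of fixed-particle-number families** exist along a subsequence and
are translation invariant and even (compactness + the structural theorems
`IsTorusLimitOf.isTranslationInvariant`, `IsTorusLimitOf.isEven`).
[cite: BratteliRobinsonI1987, Thm. 2.3.15 and §4.3.1] -/
theorem InfVolFermionState.exists_isTorusLimitOf_subseq_of_isNParticle
    (ψ : ∀ L, Fock (Orb (FermionTorus d L))) {N : ℕ → ℕ} (hN : ∀ L, IsNParticle (N L) (ψ L))
    {Ls : ℕ → ℕ} (hLs : Tendsto Ls atTop atTop) (hψ : ∀ j, star (ψ (Ls j)) ⬝ᵥ ψ (Ls j) = 1) :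
    ∃ φ : ℕ → ℕ, StrictMono φ ∧ ∃ ω : InfVolFermionState d,
      ω.IsTorusLimitOf ψ (Ls ∘ φ) ∧ ω.IsTranslationInvariant ∧ ω.IsEven := by
  obtain ⟨φ, hφ, ω, hω⟩ := InfVolFermionState.exists_isTorusLimitOf_subseq ψ hLs hψ
  exact ⟨φ, hφ, ω, hω, hω.isTranslationInvariant, hω.isEven hN⟩

end Compactness

end Literature.MathematicalPhysics.QuantumLattice

end
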